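import Summits.CriticalPhenomena.PercolationContinuityZ3.Theses.PercNearOneGluing
import Literature.Probability.Percolation.PercolationProofs
import Literature.Probability.Percolation.StarTriangleMoves
import Literature.Probability.LatticeModels.ProdBernoulliIndependence

/-!
# `AdditiveGluing` (crux stmt-CriticalPhenomena-4576): the edge-deletion identity for an
# `o`-adjacent relay (negative-side structural support, cdisprove seat)

Write `E := {o ↔ A} \ {o ↔ b}` and `F_a := {a ↮ b}`; the crux says `P(E) ≤ max_{a∈A} P(F_a)` (with
the slack bookkeeping `P(o ↔ A) − t ≤ P(o ↔ b)`, `t ≥ P(F_a)` for all `a`).  For a relay `a ∈ A`,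
`a ≠ o`, let `e = s(o,a)` and let `w[e ↦ 0]` denote the weights with the pair `{o,a}` closed.  Then
EXACTLY

  `P_w(E) − P_w(F_a) = (1 − w e) · (P_{w[e↦0]}(E) − P_{w[e↦0]}(F_a))`        (`slack_vs_adjacent_relay`)

because on `{e open}` the events `E` and `F_a` coincide (`o ↔ a`, so `o ↔ A` holds and
`o ↮ b ↔ a ↮ b`), while on `{e closed}` the configuration law is the deleted-edge law
(`prodBernoulli_map_sdiff_singleton`).

Consequences (for provers and disprovers alike):
* the comparison of `E` with an `o`-ADJACENT relay is decided in the graph WITHOUT the edge `oa`;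
  its weight only scales the slack.  So the direct edges from `o` into `A` are never where a
  counterexample is won or lost — consistent with Kozma–Nitzan Thm 4 (all neighbours of `o` in `A`
  ⇒ the inequality holds) and with the optimisers reaching ratio → 1 only through `w(oa) → 1`;
* a minimal counterexample may be searched with `w(o,a*) = 0` for the worst relay `a*` whenever
  `a*` is adjacent to `o`.
This file does NOT refute the crux.
-/

noncomputable section

namespace Summit.CriticalPhenomena.PercolationContinuityZ3.Theorems.AdditiveGluing.Negative

open MeasureTheory Set
open Literature.Probability.LatticeModels Literature.Probability.Percolation
open Literature.Probability.Percolation.StarTriangle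

variable {n : ℕ}

/-- On `{s(o,a) open}` the events `E = {o ↔ A} \ {o ↔ b}` and `F_a = {a ↮ b}` coincide
(`a ∈ A`, `o ≠ a`). -/
theorem gluingEvent_inter_open_eq (A : Finset (Fin n)) {o a : Fin n} (b : Fin n) (ha : a ∈ A)
    (hoa : o ≠ a) :
    ((⋃ x ∈ A, (openConn o x : Set (BondConfig (Fin n)))) \ openConn o b) ∩ {ω | s(o, a) ∈ ω} =
      (openConn a b)ᶜ ∩ {ω | s(o, a) ∈ ω} := by
  ext ω
  simp only [mem_inter_iff, mem_sdiff, mem_iUnion, mem_compl_iff, mem_setOf_eq, exists_prop]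
  constructor
  · rintro ⟨⟨-, hob⟩, he⟩
    refine ⟨fun hab => hob ?_, he⟩
    have hadj : (openGraph ω).Adj o a := (openGraph_adj ω o a).2 ⟨he, hoa⟩
    exact hadj.reachable.trans hab
  · rintro ⟨hab, he⟩
    have hadj : (openGraph ω).Adj o a := (openGraph_adj ω o a).2 ⟨he, hoa⟩
    refine ⟨⟨⟨a, ha, hadj.reachable⟩, fun hob => hab ?_⟩, he⟩
    exact hadj.reachable.symm.trans hob

/-- **One-bond decomposition on the closed side**: for every measurable event `S` and pair `e`,
`P_w(S ∩ {e closed}) = (1 − w e) · P_{w[e↦0]}(S)`. -/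
theorem real_inter_closed_eq (w : Sym2 (Fin n) → unitInterval) (e : Sym2 (Fin n))
    {S : Set (BondConfig (Fin n))} (hS : MeasurableSet S) :
    (prodBernoulli w).real (S ∩ {ω | e ∉ ω}) =
      (1 - (w e : ℝ)) * (prodBernoulli (Function.update w e 0)).real S := by
  classical
  have hmeas : Measurable fun ω : BondConfig (Fin n) => ω \ {e} := measurable_sdiff_const _
  -- on `{e closed}`, `ω = ω \ {e}`
  have hset : S ∩ {ω : BondConfig (Fin n) | e ∉ ω} =
      {ω | e ∉ ω} ∩ ((fun ω : BondConfig (Fin n) => ω \ {e}) ⁻¹' S) := by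
    ext ω
    simp only [mem_inter_iff, mem_setOf_eq, mem_preimage]
    constructor
    · rintro ⟨hS', he⟩
      exact ⟨he, by rwa [Set.sdiff_singleton_eq_self he]⟩
    · rintro ⟨he, hS'⟩
      exact ⟨by rwa [Set.sdiff_singleton_eq_self he] at hS', he⟩
  -- `{e closed}` is determined by `{e}`, the preimage by `{e}ᶜ`
  have hA : DeterminedBy {ω : BondConfig (Fin n) | e ∉ ω} (↑({e} : Finset (Sym2 (Fin n))) : Set _) := by
    rw [determinedBy_iff]
    intro ω ω' h
    have h1 := Set.ext_iff.1 h e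
    simp only [Finset.coe_singleton, mem_inter_iff, mem_singleton_iff, and_true] at h1
    simp only [mem_setOf_eq, h1]
  have hB : DeterminedBy ((fun ω : BondConfig (Fin n) => ω \ {e}) ⁻¹' S)
      (↑({e} : Finset (Sym2 (Fin n))) : Set _)ᶜ := by
    rw [determinedBy_iff]
    intro ω ω' h
    simp only [mem_preimage]
    have h2 : ω \ {e} = ω' \ {e} := by
      ext x
      have hx := Set.ext_iff.1 h x
      simp only [Finset.coe_singleton, mem_inter_iff, mem_compl_iff, mem_singleton_iff] at hx
      simp only [mem_sdiff, mem_singleton_iff]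
      exact hx
    rw [h2]
  rw [hset, prodBernoulli_real_inter_of_determinedBy w {e} hA hB (measurableSet_mem e).compl
      (hmeas hS), prodBernoulli_real_setOf_notMem,
    ← map_measureReal_apply hmeas hS, prodBernoulli_map_sdiff_singleton]

/-- Measurability of the gluing event `E = {o ↔ A} \ {o ↔ b}`. -/
theorem measurableSet_gluingEvent (A : Finset (Fin n)) (o b : Fin n) :
    MeasurableSet ((⋃ x ∈ A, (openConn o x : Set (BondConfig (Fin n)))) \ openConn o b) :=
  (MeasurableSet.biUnion A.countable_toSet fun x _ => measurableSet_openConn_holds o x).diff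
    (measurableSet_openConn_holds o b)

/-- **Edge-deletion identity for an `o`-adjacent relay.** For `a ∈ A`, `a ≠ o` and `e = s(o,a)`:
`P_w(E) − P_w(F_a) = (1 − w e) · (P_{w[e↦0]}(E) − P_{w[e↦0]}(F_a))` with `E = {o ↔ A} \ {o ↔ b}`,
`F_a = {a ↮ b}`.  In particular the sign of the `AdditiveGluing` slack against an `o`-adjacent
relay does not depend on the weight of the joining edge and is decided in the graph without it. -/
theorem slack_vs_adjacent_relay (w : Sym2 (Fin n) → unitInterval) (A : Finset (Fin n)) {o a : Fin n}
    (b : Fin n) (ha : a ∈ A) (hoa : o ≠ a) :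
    (prodBernoulli w).real ((⋃ x ∈ A, openConn o x) \ openConn o b) -
        (prodBernoulli w).real ((openConn a b)ᶜ) =
      (1 - (w s(o, a) : ℝ)) *
        ((prodBernoulli (Function.update w s(o, a) 0)).real ((⋃ x ∈ A, openConn o x) \ openConn o b) -
          (prodBernoulli (Function.update w s(o, a) 0)).real ((openConn a b)ᶜ)) := by
  classical
  set E : Set (BondConfig (Fin n)) := (⋃ x ∈ A, openConn o x) \ openConn o b with hE
  set F : Set (BondConfig (Fin n)) := (openConn a b)ᶜ with hF
  set Op : Set (BondConfig (Fin n)) := {ω | s(o, a) ∈ ω} with hOp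
  set Cl : Set (BondConfig (Fin n)) := {ω | s(o, a) ∉ ω} with hCl
  have hEm : MeasurableSet E := measurableSet_gluingEvent A o b
  have hFm : MeasurableSet F := (measurableSet_openConn_holds a b).compl
  have hOpm : MeasurableSet Op := measurableSet_mem _
  -- split both events along `{e open} ⊔ {e closed}`
  have hsplit : ∀ {S : Set (BondConfig (Fin n))}, MeasurableSet S →
      (prodBernoulli w).real S = (prodBernoulli w).real (S ∩ Op) + (prodBernoulli w).real (S ∩ Cl) := by
    intro S hSm
    have hU : S = (S ∩ Op) ∪ (S ∩ Cl) := by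
      ext ω; simp only [hOp, hCl, mem_union, mem_inter_iff, mem_setOf_eq]; tauto
    have hD : Disjoint (S ∩ Op) (S ∩ Cl) := by
      rw [Set.disjoint_left]
      rintro ω ⟨-, h1⟩ ⟨-, h2⟩
      exact h2 h1
    conv_lhs => rw [hU]
    exact measureReal_union hD (hSm.inter hOpm.compl)
  have hopen : E ∩ Op = F ∩ Op := gluingEvent_inter_open_eq A b ha hoa
  rw [hsplit hEm, hsplit hFm, hopen, real_inter_closed_eq w _ hEm, real_inter_closed_eq w _ hFm]
  ring

end Summit.CriticalPhenomena.PercolationContinuityZ3.Theorems.AdditiveGluing.Negative
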